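import Mathlib
import Summits.Langlands.Langlands.Theses.CapacityClassicality
import Literature.NumberTheory.Automorphic.UnboundedDenominators
import Literature.NumberTheory.ModularForms.SturmCongruenceBound
import Literature.NumberTheory.EllipticCurves.ModularCurveKleinJ
import Literature.NumberTheory.EllipticCurves.KleinJIntegralQExpansion
import Summits.Langlands.Langlands.Theorems.CapacityClassicalityIntegralOverconvergentIsCongruenceStubSupNormOfSturm
import Summits.Langlands.Langlands.Theorems.CapacityClassicalityIntegralOverconvergentIsCongruenceStubKatzSturm
import Summits.Langlands.Langlands.Theorems.CapacityClassicalityIntegralOverconvergentIsCongruenceStubKatzGain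
import Summits.Langlands.Langlands.Theorems.CapacityClassicalityIntegralOverconvergentIsCongruenceStubAuxPoly
import Summits.Langlands.Langlands.Theorems.CapacityClassicalityIntegralOverconvergentIsCongruenceStubAnalyticPackaging
import Summits.Langlands.Langlands.Theorems.CapacityClassicalityIntegralOverconvergentIsCongruenceStubMonodromy
import Summits.Langlands.Langlands.Theorems.CapacityClassicalityIntegralOverconvergentIsCongruenceStubModularOfInvariant
import Summits.Langlands.Langlands.Theorems.CapacityClassicalityIntegralOverconvergentIsCongruenceStubCongruenceEndgame

/-!
# `IntegralOverconvergentIsCongruence` — conditional on Sturm's congruence bound and on the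
unbounded denominators theorem (line `Sketch`, card `sturm-is-capacity`)

Item stmt-Langlands-8457 of route `CapacityClassicality` (decl
`Summit.Langlands.Langlands.Theses.CapacityClassicality.IntegralOverconvergentIsCongruence`, "α"): an
`𝓞_E`-integral, `p`-adically overconvergent (Katz-expansion surrogate) modular form of integer weight
whose q-expansion has radius `≥ 1` under every complex embedding is congruence-classical up to a
power of `Δ`.

This file assembles the eight PROVED stubs of the line
(`…StubSupNormOfSturm`, `…StubKatzSturm`, `…StubKatzGain`, `…StubAuxPoly`, `…StubAnalyticPackaging`,
`…StubMonodromy`, `…StubModularOfInvariant`, `…StubCongruenceEndgame`) into the crux, CONDITIONALLY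
on two published results that are not proved in Lean:

* `Literature.NumberTheory.ModularForms.Sturm1987_congruenceBound_Gamma1_modPrime` — Sturm's
  congruence bound mod `p` for cusp forms on `Γ₁(N)` with integer coefficients, `p ∤ N` (vendored by
  this line as `Literature/NumberTheory/ModularForms/SturmCongruenceBound.lean`; the only integral
  input of the `𝔭`-adic gain);
* `Literature.NumberTheory.Automorphic.CalegariDimitrovTang2025_unboundedDenominators_algInt` — the
  unbounded denominators theorem (congruence endgame).

Mechanism ("Sturm's bound is the `p`-adic capacity"): truncating the Katz expansion and applying
Sturm's bound gives the `𝔭`-adic gain `‖a_M(F)‖_𝔭 ≤ C p^{O(w)} p^{-12rM/((p-1)μ)}` at the capacity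
rate; an auxiliary-polynomial argument in the single variable `q` (Siegel over `𝓞_E`, archimedean
coefficient bounds from radius `≥ 1` at EVERY embedding, Liouville through `N_{E/ℚ}`) makes
`g¹²/Δᵏ` algebraic over `E(j)`; monodromy puts `g Δᵐ` on a finite-index `Γ'' ∋ T`; CDT and
`⟨Γ(M), T⟩ = Γ₁(M)` finish.
-/

open scoped MatrixGroups Manifold Topology
open UpperHalfPlane CongruenceSubgroup Metric PowerSeries
open Literature.NumberTheory.Automorphic
open Literature.NumberTheory.EllipticCurves Literature.NumberTheory.EllipticCurves.ModularForms

set_option linter.dupNamespace false -- project-wide option (lakefile weak.linter.dupNamespace); `Summit.Langlands.Langlands` is the mandated namespace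

noncomputable section

namespace Summit.Langlands.Langlands.Theorems.CapacityClassicality

/-- **`IntegralOverconvergentIsCongruence`, conditionally on Sturm's congruence bound and the
unbounded denominators theorem.** The composition of line `Sketch`: Katz–Sturm gain (K1) from the
sup-norm Sturm bound, Katz data for the auxiliary forms (K4), the auxiliary-polynomial transcendence
step, analytic packaging, monodromy, modularity on a finite-index level, congruence endgame. -/
theorem integralOverconvergentIsCongruence_of_sturm_of_unboundedDenominators
    (hSturm : Literature.NumberTheory.ModularForms.Sturm1987_congruenceBound_Gamma1_modPrime)
    (hCDT : CalegariDimitrovTang2025_unboundedDenominators_algInt) :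
    Summit.Langlands.Langlands.Theses.CapacityClassicality.IntegralOverconvergentIsCongruence := by
  intro p _ hp N _ hpN k ι E _ _ σ₀ a hint hrad hKatz
  obtain ⟨r, C, c, hr, hc₁, hc₂, hc₃⟩ := hKatz
  -- the sup-norm Sturm bound along `ι`, from Sturm's congruence bound mod `p`
  have hSup := stub_supNormOfSturm p N (hSturm N p Fact.out hpN) ι
  -- integer models of the q-expansions of `E₄³` and `Δ`
  obtain ⟨Z₁, hZ₁⟩ : ∃ Z₁ : PowerSeries ℤ,
      Z₁.map (Int.castRingHom ℂ) = (qExpansion 1 ⇑ModularForm.E₄) ^ 3 :=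
    ⟨formalE4 ^ 3, by rw [map_pow, qExpansion_E₄]⟩
  obtain ⟨Z₂, hZ₂⟩ : ∃ Z₂ : PowerSeries ℤ,
      Z₂.map (Int.castRingHom ℂ) = qExpansion 1 ⇑CuspForm.discriminant :=
    ⟨PowerSeries.X * formalDeltaUnit, by
      rw [CuspForm.coe_discriminant]; exact qExpansion_discriminant.symm⟩
  -- K1 + K4: the `𝔭`-adic gain for every auxiliary form
  have hKS := stub_katzSturm p hp N ι hSup
  obtain ⟨A, B, R, hA, hB, hR, hgain⟩ := stub_katzGain p hp N k ι E σ₀ a hint r C c hr hc₁ hc₂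
    hc₃ Z₁ Z₂ hZ₁ hZ₂
    (fun w C' c' F hC' h₁ h₂ h₃ M hM ↦ hKS w r C' hr hC' c' F h₁ h₂ h₃ M hM)
  -- analytic packaging at the distinguished embedding `σ₀`
  obtain ⟨hghol, hgper, hgsum, hgq, hyhol, hyper, hradE4, hradΔ, htransfer⟩ :=
    stub_analyticPackaging (fun n ↦ σ₀ (a n)) (hrad σ₀) k
  -- hypotheses of the transcendence core
  have hmapσ : ∀ (σ : E →+* ℂ) (Z : PowerSeries ℤ) (n : ℕ),
      σ (coeff n (Z.map (Int.castRingHom E))) = coeff n (Z.map (Int.castRingHom ℂ)) := by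
    intro σ Z n
    simp [PowerSeries.coeff_map]
  have hintZ : ∀ (Z : PowerSeries ℤ) (n : ℕ), IsIntegral ℤ (coeff n (Z.map (Int.castRingHom E))) := by
    intro Z n
    rw [PowerSeries.coeff_map, ← algebraMap_int_eq]
    exact isIntegral_algebraMap
  have hgi : ∀ n, IsIntegral ℤ (coeff n (PowerSeries.mk a)) := fun n ↦ by
    simpa using hint n
  have hrx₁ : ∀ (σ : E →+* ℂ) (t : ℝ), 0 < t → t < 1 →
      ∃ K : ℝ, ∀ n, ‖σ (coeff n (Z₁.map (Int.castRingHom E)))‖ * t ^ n ≤ K := by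
    intro σ t ht ht1
    obtain ⟨K, hK⟩ := hradE4 t ht ht1
    exact ⟨K, fun n ↦ by rw [hmapσ, hZ₁]; exact hK n⟩
  have hrx₂ : ∀ (σ : E →+* ℂ) (t : ℝ), 0 < t → t < 1 →
      ∃ K : ℝ, ∀ n, ‖σ (coeff n (Z₂.map (Int.castRingHom E)))‖ * t ^ n ≤ K := by
    intro σ t ht ht1
    obtain ⟨K, hK⟩ := hradΔ t ht ht1
    exact ⟨K, fun n ↦ by rw [hmapσ, hZ₂]; exact hK n⟩
  have hrg : ∀ (σ : E →+* ℂ) (t : ℝ), 0 < t → t < 1 →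
      ∃ K : ℝ, ∀ n, ‖σ (coeff n (PowerSeries.mk a))‖ * t ^ n ≤ K := by
    intro σ t ht ht1
    simpa using hrad σ t ht ht1
  -- transcendence core: a non-trivial bihomogeneous relation over `E`
  obtain ⟨D₁, D₂, P, hP0, hFP⟩ := stub_auxPoly E p
    ((ι.symm : ℂ ≃+* PadicAlgCl p).toRingHom.comp σ₀)
    (Z₁.map (Int.castRingHom E)) (Z₂.map (Int.castRingHom E)) (PowerSeries.mk a)
    k.toNat (-k).toNat (hintZ Z₁) (hintZ Z₂) hgi hrx₁ hrx₂ hrg A B R hA hB hR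
    (fun D₁ D₂ P hP M hM ↦ by simpa using hgain D₁ D₂ P hP M hM)
  -- transport the relation to complex q-series along `σ₀`
  have hmapZ : ∀ Z : PowerSeries ℤ,
      (Z.map (Int.castRingHom E)).map σ₀ = Z.map (Int.castRingHom ℂ) := by
    intro Z
    rw [← RingHom.comp_apply (PowerSeries.map σ₀), ← PowerSeries.map_comp,
      RingHom.ext_int (σ₀.comp (Int.castRingHom E)) (Int.castRingHom ℂ)]
  have hmapg : (PowerSeries.mk a).map σ₀ = PowerSeries.mk (fun n ↦ σ₀ (a n)) := by
    ext n
    simp [PowerSeries.coeff_map]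
  have hFPC := congrArg (PowerSeries.map σ₀) hFP
  simp only [map_sum, map_mul, map_pow, PowerSeries.map_C, hmapZ, hZ₁, hZ₂, hmapg, map_zero]
    at hFPC
  have hc0 : (fun i j ↦ σ₀ (P i j)) ≠ 0 := by
    intro h
    apply hP0
    funext i j
    have hij := congrFun (congrFun h i) j
    simp only [Pi.zero_apply] at hij
    exact (map_eq_zero_iff σ₀ σ₀.injective).mp hij
  have hrel := htransfer D₁ D₂ (fun i j ↦ σ₀ (P i j)) hFPC
  -- monodromy: finite-index invariance of `y = g¹²/Δᵏ` and growth of its translates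
  obtain ⟨Γ', hΓ', hT', hinv, A', K', T₀, hgrowth⟩ := stub_monodromy
    (fun τ : ℍ ↦ (∑' n : ℕ, σ₀ (a n) * Function.Periodic.qParam 1 (τ : ℂ) ^ n) ^ 12 /
      ModularForm.discriminant τ ^ k)
    hyhol hyper D₁ D₂ (fun i j ↦ σ₀ (P i j)) hc0 hrel
  haveI := hΓ'
  -- `g Δᵐ` is a modular form on a finite-index `Γ'' ∋ T`
  obtain ⟨Γ'', hΓ'', m, f, hT'', hqf⟩ := stub_modularOfInvariant (fun n ↦ σ₀ (a n)) k hghol hgper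
    hgsum hgq Γ' hT' hinv A' K' T₀ hgrowth
  haveI := hΓ''
  -- endgame: Calegari–Dimitrov–Tang + `⟨Γ(M), T⟩ = Γ₁(M)`
  obtain ⟨M, hM, F, hF⟩ := stub_congruenceEndgame hCDT σ₀ a hint Γ'' hT'' (k + 12 * m) m f hqf
  exact ⟨M, hM, m, F, hF.trans hqf⟩

end Summit.Langlands.Langlands.Theorems.CapacityClassicality

end
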